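import Summits.NavierStokesRegularity.OSWSelfSimilar.CertificateViscousSheetRFixedPoint
import HarnessLib
/-!
# Z3-SR-CERT, IMPLEMENTATION 2 (F5(b)): the certified point `(a, c_l, ε) = (1/5, 1/2, 1)` re-derived by a code-disjoint arithmetic

HONEST FRAMING (cell ns-blowup GROUP B, zone Z3, case Z3-SR-CERT; PROFILE-SPEC v1.3; profile-lead RULINGS (ay)/(az)(2)/(cl)/(dx)(5)/(dz)/(ek)(3)):
**1-D MODEL (viscous gCLM/OSW sheet on `ℝ` at `c_l = 1/2`), computer-assisted; not Euler, not Navier–Stokes; «violates: none — MODEL»;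
census hook `Literature.Analysis.FluidPDE.effectiveViscosity_half`.**  Companion of the implementation-1 row `CertificateViscousSheetR.lean`
(python-flint/Arb, seat profile-cert-1), of the kernel chain `CertificateViscousSheetRChain.lean` and of the fixed-point form
`CertificateViscousSheetRFixedPoint.lean`.  Nothing here is a statement about Navier–Stokes.

IMPLEMENTATION 2 (seats ns-blowup-profile-cert-2 g4 + g5): numpy float64/complex128 MID-RAD interval arithmetic (Higham γ_n model) + CPython
`fractions`; NO flint/Arb.  Trigonometric functions as `ζ = e^{iθ/2}` Laurent polynomials; Hilbert-transform images by the circle rule; adjoints as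
plain `L²(dθ)` adjoints in the `(1 + cos)`-factored variables; `β`, `β†` tabulated on the sine basis (β is linear) and all `2N` residual enclosures
by one interval GEMM, the half-family column `Ξ = β(sin θ/2)` paired by the `J`-kernel and its integer-sine-series tail by the exact large-`k`
moment expansion `⟨Ξ, sin kθ⟩ = (2(−1)^{k+1}/k) Σ_m μ_m (P/2k)^{2m}`; Gram / capacitance matrices from the float stage `(V, Z, γ)` with
closed-form basis integrals (capacitance entries cross-checked in-job against generic ζ-products to `2e-14`); `‖X‖₂ = λ_max(XᵀX)^{1/2}`
and every `λ_max` by the symmetric eigenvector-similarity bound `ρ(M) ≤ ‖QᵀMQ‖_∞/(1 − ‖I − QᵀQ‖_∞)`; `C⁻¹ = (XC)⁻¹X` (Neumann);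
the pencils `Λ = λ_max(G(z) C⁻ᵀ G_E(v) C⁻¹)` at the OPERATOR level `√Λ = ‖T_v C⁻¹ T_z*‖ ≤ ‖G̃_v^{1/2} X G̃_z^{1/2}‖ + ρ_F‖C⁻¹‖(‖T_z̃‖ + 2σ_F)
+ ‖T_ṽ‖‖C⁻¹ − X‖(‖T_z̃‖ + 2σ_F) + ‖T_ṽ‖‖X‖·2σ_F`, with `λ_max(G̃_z XᵀG̃_v X)` enclosed three ways (double float-Cholesky symmetrisation with
interval defects / single Cholesky / non-symmetric similarity; minimum used).  Shared DATA of record: centre `c4de65e13d80c930`, float stage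
j255015 (`npz` sha16 `e16fb74b8c424857`).  Jobs: j262096 (part 1) + j265379 (parts 2–3) (code sha16: zeta e5ee67b1376f211e, sheet 5380a9b2c904a5f0, sheet2 1550bee99b62a579, sheet3 7c9ee9c3b1204be7,
run2 188b359a439c0c44; deposit `HOME/profile/cert/impl2/sheetR-F5b/` with MANIFEST).

AGREEMENT WITH IMPLEMENTATION 1 (printed numbers, impl-2 ∥ impl-1): `ρ_F` 0.002777 ∥ 3.215e-3, `σ_F` 0.0001324 ∥ 2.060e-4, `‖C̃⁻¹‖₂` 13.156231 ∥
13.1562309, `Λ̃_W` 154075248 ∥ 1.54075247e8, `Λ̃_E` 75866652 ∥ 7.5866649e7, corrections `√Λ`: 1066.5 / 1340.7 ∥ 1270.2 / 1596.6,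
`K_Nw` 6.19002 ∥ 6.2534, `K_N*` 4.1243 ∥ 4.2039.  The ONLY large difference is `η`: impl-2's `‖G(Ω̄)‖_{X*}` is the float64 FLOOR 0.00048511 of its
mid-rad arithmetic (the residual's integer- and half-integer families cancel to 17 digits), vs impl-1's Arb value 9.07e-7 — so the impl-2 ball is
wider (`rEB` below), still far inside the uniqueness window; the two certified zeros coincide (`rE_le_rEB`, same centre).

1. **Data** (outward decimal roundings of the impl-2 enclosures): `epsNB` (the C–S constant of record `D = 2.74673`, RULING (dz)(1); UP),
   `KNwB`, `KNstarB`, `KB`, `etaB`, `hB`, `rEB` (crude `2Kη`), `rSupB`, `rEsharpB` (the NK radius itself), `rSupSharpB`.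
2. **Kernel-checked arithmetic** (`norm_num`): `KNwB_mul_epsNB_lt_one`, `KB_ge`, `hB_ge`, `hB_lt_half`, `rEB_ge`, `rSupB_sq_ge`, the uniqueness
   window `rEB_mul_KB_mul_Llip_lt_one`, the sharp radius `rEsharpB_sq_le` (+ real form `nk_radius_le_rEsharpB`), the AGREEMENT facts `rE_le_rEB`,
   `rEsharp_le_rEsharpB` (implementation 2's ball contains implementation 1's: same centre, so by uniqueness in the larger ball the two certified zeros
   coincide) and `KNwB_le_KNw`, `KNstarB_le_KNstar` (both implementations bound the same frame constants; informational).
3. **Composition** `existsUnique_fixedPoint_of_rowB`: the row's sentence in the fixed-point form of `CertificateViscousSheetRFixedPoint` at the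
   impl-2 literals — for `S` with `‖Sφ‖ ≤ KB‖φ‖`, `‖Q u v‖ ≤ M‖u‖‖v‖`, `2M ≤ Llip`, `‖g₀‖ ≤ etaB`: exactly one `δ` with `‖δ‖ ≤ rEB` and
   `δ = −S(g₀ + Q δ δ)`.
4. Word of this implementation (job j262096 (part 1) + j265379 (parts 2–3)): «CERTIFIED MODEL PROFILE (F5(b), implementation 2 = numpy mid-rad + fractions, no Arb; MODEL): exists unique odd Om* in E with ||Om* - Om_bar||_E <= 0.00375983, sup|Om* - Om_bar| <= 0.00066465 (uniqueness in every E-ball of radius < 0.069236); ||DG(Om_bar)^-1||_{X*->E} <= K = 7.54006; c_lambda = 1, K_Nw = 6.19001, K_N* = 4.12429, eps_N = 0.073185 (D = 2.74673, constant of record), K_Nw eps_N = 0.453016 < 1, h = 0.0528298 < 1/2; same centre as implementation 1 and r_E(impl-2) >= r_E(impl-1) = 1.189e-5 => the two certified zeros coincide».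
**What is NOT kernel-checked:** as in the implementation-1 row — (i) that impl-2's interval arithmetic establishes the bounds with these literals;
(ii) the MODEL ASSEMBLY (frame identities (E1)–(E5), Woodbury/adjoint representation (C2)); the chain (C1)–(C4) itself is kernel
(`CoerciveFiniteRankNewtonKantorovich`, `CertificateViscousSheetRChain`, `CertificateViscousSheetRFixedPoint`).  WHAT THIS IS NOT: not NS.
-/

noncomputable section

open Metric Set

namespace Summit.NavierStokesRegularity.OSWSelfSimilar
namespace CertificateViscousSheetR

open Literature.Analysis.Calculus

/-- impl-2: `ε_N ≥ ‖Π_T P‖_{E → L²_w}` at `N = 1200` under the C–S constant of record `D = 2.74673` (UP; value 0.073185). [folklore] -/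
def epsNB : ℚ := (14637 : ℚ) / 200000
/-- impl-2: `K_Nw ≥ ‖(B_λ − Π_H P)⁻¹‖_{L²_w → E}` (UP; value 6.19002). [folklore] -/
def KNwB : ℚ := (309501 : ℚ) / 50000
/-- impl-2: `K_N* ≥ ‖(B_λ − Π_H P)⁻¹‖_{X* → E}` (UP; value 4.1243). [folklore] -/
def KNstarB : ℚ := (41243 : ℚ) / 10000
/-- impl-2: `K ≥ K_N*/(1 − K_Nw ε_N) ≥ ‖DG(Ω̄)⁻¹‖_{X* → E}` (UP; value 7.54009). [folklore] -/
def KB : ℚ := (754009 : ℚ) / 100000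
/-- impl-2: `η ≥ ‖G(Ω̄)‖_{X*} = 2‖G(Ω̄)‖_w` — the float64 floor of the mid-rad arithmetic (UP; value 0.00048511). [folklore] -/
def etaB : ℚ := (48511 : ℚ) / 100000000
/-- impl-2: `h ≥ K²·L_lip·η` (UP; value 0.052831). [folklore] -/
def hB : ℚ := (52831 : ℚ) / 1000000
/-- impl-2: crude energy-norm radius `rE ≥ 2Kη ≥ (1 − √(1−2h))/(K L_lip)` (UP; value 0.007316). [folklore] -/
def rEB : ℚ := (1829 : ℚ) / 250000
/-- impl-2: crude sup-norm radius `≥ √2·rEB/L` (UP; value 0.001294). [folklore] -/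
def rSupB : ℚ := (647 : ℚ) / 500000
/-- impl-2: sharp energy-radius literal `rE♯ ≥ (1 − √(1 − 2h))/(K·L_lip)` — the Newton–Kantorovich radius itself (UP; value 0.00376). [folklore] -/
def rEsharpB : ℚ := (47 : ℚ) / 12500
/-- impl-2: sharp sup-radius literal `≥ √2·rE♯/L ≥ sup|Ω* − Ω̄|` (UP; value 0.0006647). [folklore] -/
def rSupSharpB : ℚ := (6647 : ℚ) / 10000000

/-- impl-2: the perturbation step closes, `K_Nw·ε_N < 1`. [folklore] -/
theorem KNwB_mul_epsNB_lt_one : KNwB * epsNB < 1 := by norm_num [KNwB, epsNB]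
/-- impl-2: `KB` dominates `K_N*/(1 − K_Nw ε_N)`. [folklore] -/
theorem KB_ge : KNstarB / (1 - KNwB * epsNB) ≤ KB := by norm_num [KNstarB, KNwB, epsNB, KB]
/-- impl-2: `hB` dominates `K²·L_lip·η` (with the shared closed-form `Llip`). [folklore] -/
theorem hB_ge : KB ^ 2 * Llip * etaB ≤ hB := by norm_num [KB, Llip, etaB, hB]
/-- impl-2: the Newton–Kantorovich discriminant is below `1/2`. [folklore] -/
theorem hB_lt_half : hB < 1 / 2 := by norm_num [hB]
/-- impl-2: `rEB ≥ 2·K·η`. [folklore] -/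
theorem rEB_ge : 2 * KB * etaB ≤ rEB := by norm_num [KB, etaB, rEB]
/-- impl-2: `rSupB² ≥ 2 rEB²/L²` (so `rSupB ≥ √2·rEB/L`). [folklore] -/
theorem rSupB_sq_ge : 2 * rEB ^ 2 / (L : ℚ) ^ 2 ≤ rSupB ^ 2 := by norm_num [rEB, rSupB, L]
/-- impl-2: the uniqueness window closes on the printed literals, `rEB · KB · Llip < 1`. [folklore] -/
theorem rEB_mul_KB_mul_Llip_lt_one : rEB * KB * Llip < 1 := by norm_num [rEB, KB, Llip]
/-- impl-2: positivity bookkeeping for the casts. [folklore] -/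
theorem KB_pos_and_etaB_nonneg : 0 < KB ∧ 0 ≤ etaB ∧ 0 ≤ epsNB ∧ 0 ≤ KNwB := by
  refine ⟨?_, ?_, ?_, ?_⟩ <;> norm_num [KB, etaB, epsNB, KNwB]

/-- impl-2: `0 ≤ 1 − rE♯·K·L_lip` (squaring below is legitimate). [folklore] -/
theorem one_sub_rEsharpB_mul_nonneg : 0 ≤ 1 - rEsharpB * KB * Llip := by norm_num [rEsharpB, KB, Llip]
/-- impl-2: `(1 − rE♯·K·L_lip)² ≤ 1 − 2h`, i.e. `rE♯ ≥ (1 − √(1 − 2h))/(K·L_lip)` at the literals. [folklore] -/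
theorem rEsharpB_sq_le : (1 - rEsharpB * KB * Llip) ^ 2 ≤ 1 - 2 * hB := by norm_num [rEsharpB, KB, Llip, hB]
/-- impl-2: the sharp literal improves the crude `2Kη` literal. [folklore] -/
theorem rEsharpB_le_rEB : rEsharpB ≤ rEB := by norm_num [rEsharpB, rEB]
/-- impl-2: `rSup♯² ≥ 2·rE♯²/L²`. [folklore] -/
theorem rSupSharpB_sq_ge : 2 * rEsharpB ^ 2 / (L : ℚ) ^ 2 ≤ rSupSharpB ^ 2 := by norm_num [rEsharpB, rSupSharpB, L]

/-- Real form: the Newton–Kantorovich radius `(1 − √(1 − 2hB))/(KB·L_lip)` at the impl-2 literals is at most `rE♯_B`. [folklore] -/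
theorem nk_radius_le_rEsharpB :
    (1 - Real.sqrt (1 - 2 * (hB : ℝ))) / ((KB : ℝ) * (Llip : ℝ)) ≤ (rEsharpB : ℝ) := by
  have hKL : (0 : ℝ) < (KB : ℝ) * (Llip : ℝ) := by norm_num [KB, Llip]
  have h1 : (1 - (rEsharpB : ℝ) * KB * Llip) ^ 2 ≤ 1 - 2 * (hB : ℝ) := by exact_mod_cast rEsharpB_sq_le
  have h2 : 1 - (rEsharpB : ℝ) * KB * Llip ≤ Real.sqrt (1 - 2 * (hB : ℝ)) := Real.le_sqrt_of_sq_le h1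
  rw [div_le_iff₀ hKL]
  nlinarith [h2]

/-- AGREEMENT (F5(a)+(b)): implementation 2's energy ball contains implementation 1's crude-literal ball (same centre `c4de65e13d80c930`), so by
uniqueness in the larger ball the two certified zeros coincide. [folklore] -/
theorem rE_le_rEB : rE ≤ rEB := by norm_num [rE, rEB]
/-- AGREEMENT, sharp literals: implementation 1's NK radius literal is inside implementation 2's. [folklore] -/
theorem rEsharp_le_rEsharpB : rEsharp ≤ rEsharpB := by norm_num [rEsharp, rEsharpB]
/-- AGREEMENT of the frame constants (informational: both literals are certified upper bounds of the same `‖(B_λ − Π_H P)⁻¹‖_{L²_w → E}`;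
implementation 2's is the smaller one because its forward residuals are smaller). [folklore] -/
theorem KNwB_le_KNw : KNwB ≤ KNw := by norm_num [KNwB, KNw]
/-- AGREEMENT of the frame constants, `X*`-keyed (informational, as `KNwB_le_KNw`). [folklore] -/
theorem KNstarB_le_KNstar : KNstarB ≤ KNstar := by norm_num [KNstarB, KNstar]

variable {E : Type*} [NormedAddCommGroup E] [NormedSpace ℝ E] [CompleteSpace E]
variable {Xs : Type*} [NormedAddCommGroup Xs] [NormedSpace ℝ Xs]

/-- **The row's sentence at the implementation-2 literals, fixed-point form** (`CertificateViscousSheetRFixedPoint.existsUnique_fixedPoint_quadratic`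
composed with `KB, Llip, etaB, hB, rEB`): for `S : X* → E` with `‖Sφ‖ ≤ KB‖φ‖` (the solution operator of `DG(Ω̄)`, impl-2's bound), a bilinear
`Q` with `‖Q u v‖ ≤ M‖u‖‖v‖` and `2M ≤ Llip`, and a residual `‖g₀‖ ≤ etaB`, the closed `E`-ball of radius `rEB` about `0` contains EXACTLY ONE `δ` with
`δ = −S(g₀ + Q δ δ)` (reading: `Ω* = Ω̄ + δ` is the unique zero of `G` in `B̄_E(Ω̄, rEB)`).  MODEL; the interval arithmetic behind the literals and
the model assembly are hypotheses, exactly as in `existsUnique_fixedPoint_of_row`. [folklore] -/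
theorem existsUnique_fixedPoint_of_rowB (S : Xs →L[ℝ] E) (Q : E →L[ℝ] E →L[ℝ] Xs) (g₀ : Xs) {M : ℝ} (hM : 0 < M)
    (hS : ∀ φ, ‖S φ‖ ≤ (KB : ℝ) * ‖φ‖) (hQ : ∀ u v, ‖Q u v‖ ≤ M * ‖u‖ * ‖v‖) (hLlip : 2 * M ≤ (Llip : ℝ))
    (hη : ‖g₀‖ ≤ (etaB : ℝ)) :
    ∃ δ ∈ closedBall (0 : E) (rEB : ℝ), δ = -S (g₀ + Q δ δ) ∧
      ∀ δ' ∈ closedBall (0 : E) (rEB : ℝ), δ' = -S (g₀ + Q δ' δ') → δ' = δ := by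
  obtain ⟨hKpos, heta0, -, -⟩ := KB_pos_and_etaB_nonneg
  obtain ⟨-, hLlippos, -, -, -⟩ := K_pos_and_Llip_pos
  have hKposR : (0 : ℝ) < (KB : ℝ) := by exact_mod_cast hKpos
  have hetaR : (0 : ℝ) ≤ (etaB : ℝ) := by exact_mod_cast heta0
  have hhge : (KB : ℝ) ^ 2 * (Llip : ℝ) * (etaB : ℝ) ≤ (hB : ℝ) := by have h' := hB_ge; exact_mod_cast h'
  have hhlt : 2 * ((hB : ℚ) : ℝ) < 1 := by
    have h' : 2 * hB < 1 := by have := hB_lt_half; linarith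
    exact_mod_cast h'
  have hrEge : 2 * (KB : ℝ) * (etaB : ℝ) ≤ (rEB : ℝ) := by have h' := rEB_ge; exact_mod_cast h'
  have hwin : (rEB : ℝ) * (KB : ℝ) * (Llip : ℝ) < 1 := by have h' := rEB_mul_KB_mul_Llip_lt_one; exact_mod_cast h'
  have hg0 : 0 ≤ ‖g₀‖ := norm_nonneg _
  -- the actual discriminant is below the impl-2 `hB`
  have hK2 : (0 : ℝ) ≤ (KB : ℝ) ^ 2 := sq_nonneg _
  have hle : (KB : ℝ) ^ 2 * (2 * M) * ‖g₀‖ ≤ (KB : ℝ) ^ 2 * (Llip : ℝ) * (etaB : ℝ) := by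
    have h1 : (KB : ℝ) ^ 2 * (2 * M) ≤ (KB : ℝ) ^ 2 * (Llip : ℝ) := mul_le_mul_of_nonneg_left hLlip hK2
    exact mul_le_mul h1 hη hg0 (by positivity)
  have hh : 2 * ((KB : ℝ) ^ 2 * (2 * M) * ‖g₀‖) < 1 := by linarith
  -- Kantorovich radius ≤ 2K‖g₀‖ ≤ 2K·etaB ≤ rEB
  have hr : (1 - Real.sqrt (1 - 2 * ((KB : ℝ) ^ 2 * (2 * M) * ‖g₀‖))) / ((KB : ℝ) * (2 * M)) ≤ (rEB : ℝ) := by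
    refine (kantorovich_radius_le hKposR (by positivity) hg0 hh.le).trans ?_
    calc 2 * (KB : ℝ) * ‖g₀‖ ≤ 2 * (KB : ℝ) * (etaB : ℝ) := by gcongr
      _ ≤ (rEB : ℝ) := hrEge
  -- contraction window
  have hrE0 : (0 : ℝ) ≤ (rEB : ℝ) := le_trans (by positivity) hrEge
  have hr' : (rEB : ℝ) * (KB : ℝ) * (2 * M) < 1 := by
    calc (rEB : ℝ) * (KB : ℝ) * (2 * M) ≤ (rEB : ℝ) * (KB : ℝ) * (Llip : ℝ) :=
          mul_le_mul_of_nonneg_left hLlip (mul_nonneg hrE0 hKposR.le)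
      _ < 1 := hwin
  exact existsUnique_fixedPoint_quadratic S Q g₀ hKposR hM hS hQ le_rfl hh hr hr'


/-! ### Append (seat ns-blowup-profile-cert-2 g5, same session): the SHARP-`D` column OF RECORD — RULINGS (ex)(1)/(fc)(1)
Since profile-lead RULING (ex)(1) the (E5) constant of record is the SHARP pair «`D = 2.14996` (impl-1) / `2.15164` (impl-2)», KERNEL and
unconditional on the registered energy class (`SheetRVelocityEndpointClass.integral_velocity_sq_le_of_primitive` /
`…_energy_of_primitive`, composing `SheetRVelocityWirtinger` §4); the Cauchy–Schwarz constant `2.74673` of the first block (`epsNB`, `KB`, `hB`,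
`rEB`, …) is the bracketed conservative column.  The literals below re-run implementation 2's chain under ITS OWN sharp constant
(`ε_N = 32·2.151636/1201 ≤ 0.0573292`; `KNwB`, `KNstarB`, `Llip`, `etaB` unchanged — they do not depend on `D`): the certificate closes with
`K ≤ 6.39297`, `h ≤ 0.037979`, crude radius `2Kη ≤ 0.006203`, NK radius `≤ 0.003163`, sup `≤ 0.0005592` (job j265379 `part3.json` f418d8bec31175e0,
`chains.PRICE_2`).  MODEL bookkeeping; not NS. -/

/-- impl-2, sharp column of record: `ε_N` under impl-2's own sharp (E5) constant `D = 2.151636` (UP; value 0.0573292). [folklore] -/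
def epsNBR : ℚ := (143323 : ℚ) / 2500000
/-- impl-2, sharp column: `K ≥ K_N*/(1 − K_Nw ε_N)` (UP; value 6.39297). [folklore] -/
def KBR : ℚ := (639297 : ℚ) / 100000
/-- impl-2, sharp column: `h ≥ K²·L_lip·η` (UP; value 0.037979). [folklore] -/
def hBR : ℚ := (37979 : ℚ) / 1000000
/-- impl-2, sharp column: crude energy radius `≥ 2Kη` (UP; value 0.006203). [folklore] -/
def rEBR : ℚ := (6203 : ℚ) / 1000000
/-- impl-2, sharp column: crude sup radius `≥ √2·rEBR/L` (UP; value 0.001097). [folklore] -/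
def rSupBR : ℚ := (1097 : ℚ) / 1000000
/-- impl-2, sharp column: the Newton–Kantorovich radius literal `≥ (1 − √(1 − 2h))/(K·L_lip)` (UP; value 0.003163). [folklore] -/
def rEsharpBR : ℚ := (3163 : ℚ) / 1000000
/-- impl-2, sharp column: sup radius `≥ √2·rE♯/L` (UP; value 0.0005592). [folklore] -/
def rSupSharpBR : ℚ := (699 : ℚ) / 1250000

/-- sharp column: the sharp constant is below the bracketed Cauchy–Schwarz one (`epsNBR ≤ epsNB`). [folklore] -/
theorem epsNBR_le_epsNB : epsNBR ≤ epsNB := by norm_num [epsNBR, epsNB]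
/-- sharp column: the perturbation step closes, `K_Nw·ε_N < 1`. [folklore] -/
theorem KNwB_mul_epsNBR_lt_one : KNwB * epsNBR < 1 := by norm_num [KNwB, epsNBR]
/-- sharp column: `KBR ≥ K_N*/(1 − K_Nw ε_N)`. [folklore] -/
theorem KBR_ge : KNstarB / (1 - KNwB * epsNBR) ≤ KBR := by norm_num [KNstarB, KNwB, epsNBR, KBR]
/-- sharp column: `KBR ≤ KB` (a smaller remainder gives a smaller inverse bound). [folklore] -/
theorem KBR_le_KB : KBR ≤ KB := by norm_num [KBR, KB]
/-- sharp column: `hBR ≥ KBR²·L_lip·η`. [folklore] -/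
theorem hBR_ge : KBR ^ 2 * Llip * etaB ≤ hBR := by norm_num [KBR, Llip, etaB, hBR]
/-- sharp column: the Newton–Kantorovich discriminant is below `1/2`. [folklore] -/
theorem hBR_lt_half : hBR < 1 / 2 := by norm_num [hBR]
/-- sharp column: `rEBR ≥ 2·KBR·η`. [folklore] -/
theorem rEBR_ge : 2 * KBR * etaB ≤ rEBR := by norm_num [KBR, etaB, rEBR]
/-- sharp column: `rSupBR² ≥ 2 rEBR²/L²`. [folklore] -/
theorem rSupBR_sq_ge : 2 * rEBR ^ 2 / (L : ℚ) ^ 2 ≤ rSupBR ^ 2 := by norm_num [rEBR, rSupBR, L]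
/-- sharp column: the uniqueness window closes, `rEBR · KBR · Llip < 1`. [folklore] -/
theorem rEBR_mul_KBR_mul_Llip_lt_one : rEBR * KBR * Llip < 1 := by norm_num [rEBR, KBR, Llip]
/-- sharp column: `0 ≤ 1 − rE♯·K·L_lip`. [folklore] -/
theorem one_sub_rEsharpBR_mul_nonneg : 0 ≤ 1 - rEsharpBR * KBR * Llip := by norm_num [rEsharpBR, KBR, Llip]
/-- sharp column: `(1 − rE♯·K·L_lip)² ≤ 1 − 2h` (the NK radius at the literals is at most `rEsharpBR`). [folklore] -/
theorem rEsharpBR_sq_le : (1 - rEsharpBR * KBR * Llip) ^ 2 ≤ 1 - 2 * hBR := by norm_num [rEsharpBR, KBR, Llip, hBR]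
/-- sharp column: the sharp literal improves the crude one. [folklore] -/
theorem rEsharpBR_le_rEBR : rEsharpBR ≤ rEBR := by norm_num [rEsharpBR, rEBR]
/-- sharp column: `rSup♯² ≥ 2·rE♯²/L²`. [folklore] -/
theorem rSupSharpBR_sq_ge : 2 * rEsharpBR ^ 2 / (L : ℚ) ^ 2 ≤ rSupSharpBR ^ 2 := by norm_num [rEsharpBR, rSupSharpBR, L]
/-- Real form: the Newton–Kantorovich radius `(1 − √(1 − 2hBR))/(KBR·L_lip)` is at most `rEsharpBR`. [folklore] -/
theorem nk_radius_le_rEsharpBR :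
    (1 - Real.sqrt (1 - 2 * (hBR : ℝ))) / ((KBR : ℝ) * (Llip : ℝ)) ≤ (rEsharpBR : ℝ) := by
  have hKL : (0 : ℝ) < (KBR : ℝ) * (Llip : ℝ) := by norm_num [KBR, Llip]
  have h1 : (1 - (rEsharpBR : ℝ) * KBR * Llip) ^ 2 ≤ 1 - 2 * (hBR : ℝ) := by exact_mod_cast rEsharpBR_sq_le
  have h2 : 1 - (rEsharpBR : ℝ) * KBR * Llip ≤ Real.sqrt (1 - 2 * (hBR : ℝ)) := Real.le_sqrt_of_sq_le h1
  rw [div_le_iff₀ hKL]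
  nlinarith [h2]
/-- AGREEMENT (sharp column): implementation 2's crude-literal ball contains implementation 1's (same centre) ⇒ same zero. [folklore] -/
theorem rE_le_rEBR : rE ≤ rEBR := by norm_num [rE, rEBR]
/-- AGREEMENT (sharp column, NK literals): implementation 1's NK radius literal is inside implementation 2's. [folklore] -/
theorem rEsharp_le_rEsharpBR : rEsharp ≤ rEsharpBR := by norm_num [rEsharp, rEsharpBR]
/-- sharp column: positivity bookkeeping. [folklore] -/
theorem KBR_pos : 0 < KBR := by norm_num [KBR]

/-- **The row's sentence at implementation 2's SHARP-column literals, fixed-point form**: as `existsUnique_fixedPoint_of_rowB` with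
`(KBR, hBR, rEBR)` in place of `(KB, hB, rEB)` — for `‖Sφ‖ ≤ KBR‖φ‖`, `‖Q u v‖ ≤ M‖u‖‖v‖`, `2M ≤ Llip`, `‖g₀‖ ≤ etaB`, exactly one `δ` with
`‖δ‖ ≤ rEBR` and `δ = −S(g₀ + Q δ δ)`.  MODEL; interval arithmetic and model assembly are hypotheses. [folklore] -/
theorem existsUnique_fixedPoint_of_rowBR (S : Xs →L[ℝ] E) (Q : E →L[ℝ] E →L[ℝ] Xs) (g₀ : Xs) {M : ℝ} (hM : 0 < M)
    (hS : ∀ φ, ‖S φ‖ ≤ (KBR : ℝ) * ‖φ‖) (hQ : ∀ u v, ‖Q u v‖ ≤ M * ‖u‖ * ‖v‖) (hLlip : 2 * M ≤ (Llip : ℝ))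
    (hη : ‖g₀‖ ≤ (etaB : ℝ)) :
    ∃ δ ∈ closedBall (0 : E) (rEBR : ℝ), δ = -S (g₀ + Q δ δ) ∧
      ∀ δ' ∈ closedBall (0 : E) (rEBR : ℝ), δ' = -S (g₀ + Q δ' δ') → δ' = δ := by
  obtain ⟨-, heta0, -, -⟩ := KB_pos_and_etaB_nonneg
  obtain ⟨-, hLlippos, -, -, -⟩ := K_pos_and_Llip_pos
  have hKposR : (0 : ℝ) < (KBR : ℝ) := by exact_mod_cast KBR_pos
  have hetaR : (0 : ℝ) ≤ (etaB : ℝ) := by exact_mod_cast heta0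
  have hhge : (KBR : ℝ) ^ 2 * (Llip : ℝ) * (etaB : ℝ) ≤ (hBR : ℝ) := by have h' := hBR_ge; exact_mod_cast h'
  have hhlt : 2 * ((hBR : ℚ) : ℝ) < 1 := by
    have h' : 2 * hBR < 1 := by have := hBR_lt_half; linarith
    exact_mod_cast h'
  have hrEge : 2 * (KBR : ℝ) * (etaB : ℝ) ≤ (rEBR : ℝ) := by have h' := rEBR_ge; exact_mod_cast h'
  have hwin : (rEBR : ℝ) * (KBR : ℝ) * (Llip : ℝ) < 1 := by have h' := rEBR_mul_KBR_mul_Llip_lt_one; exact_mod_cast h'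
  have hg0 : 0 ≤ ‖g₀‖ := norm_nonneg _
  have hK2 : (0 : ℝ) ≤ (KBR : ℝ) ^ 2 := sq_nonneg _
  have hle : (KBR : ℝ) ^ 2 * (2 * M) * ‖g₀‖ ≤ (KBR : ℝ) ^ 2 * (Llip : ℝ) * (etaB : ℝ) := by
    have h1 : (KBR : ℝ) ^ 2 * (2 * M) ≤ (KBR : ℝ) ^ 2 * (Llip : ℝ) := mul_le_mul_of_nonneg_left hLlip hK2
    exact mul_le_mul h1 hη hg0 (by positivity)
  have hh : 2 * ((KBR : ℝ) ^ 2 * (2 * M) * ‖g₀‖) < 1 := by linarith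
  have hr : (1 - Real.sqrt (1 - 2 * ((KBR : ℝ) ^ 2 * (2 * M) * ‖g₀‖))) / ((KBR : ℝ) * (2 * M)) ≤ (rEBR : ℝ) := by
    refine (kantorovich_radius_le hKposR (by positivity) hg0 hh.le).trans ?_
    calc 2 * (KBR : ℝ) * ‖g₀‖ ≤ 2 * (KBR : ℝ) * (etaB : ℝ) := by gcongr
      _ ≤ (rEBR : ℝ) := hrEge
  have hrE0 : (0 : ℝ) ≤ (rEBR : ℝ) := le_trans (by positivity) hrEge
  have hr' : (rEBR : ℝ) * (KBR : ℝ) * (2 * M) < 1 := by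
    calc (rEBR : ℝ) * (KBR : ℝ) * (2 * M) ≤ (rEBR : ℝ) * (KBR : ℝ) * (Llip : ℝ) :=
          mul_le_mul_of_nonneg_left hLlip (mul_nonneg hrE0 hKposR.le)
      _ < 1 := hwin
  exact existsUnique_fixedPoint_quadratic S Q g₀ hKposR hM hS hQ le_rfl hh hr hr'


/-! ### Append 2 (seat ns-blowup-profile-cert-2 g5, same session): F5(c) — the η UPGRADE and implementation 2's LOCATION radius
Licence RULING (fc)(1)(d)/(fe)(3).  Job j266141 (`etaexact.py` 41e43056cdf286d1; deposit `HOME/profile/cert/impl2/sheetR-F5c/`): `η = ‖G(Ω̄)‖_{X*} ≤ 2‖G(Ω̄)‖_w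
= 64‖g‖_{L²(dθ)}` re-derived in EXACT INTEGER ARITHMETIC (every ζ-coefficient of `5g = A + B/π` an exact big integer on a dyadic grid; products by
Kronecker substitution on CPython integers; `‖5g‖² = Σ a_p a_q J(p+q)` assembled as `π r₀ + r₁ + r₂/π + r₃/π²` with exact rationals and a
40-digit rational bracket of `π`; series coefficients of `𝒰S`, `𝒰T₂`, `HT₂` rounded to `2^-100`, truncations `K_U = 131072`, `K_H = 65536`, all as ADDED
`L²` slacks): `‖g‖_{L²(dθ)} ≤ 6.45648e-09`, `‖G(Ω̄)‖_w ≤ 2.06607e-07` (impl-1 Arb: 4.5351e-7), **`η ≤ 4.1322e-07`** (impl-1: 9.0701e-7; the float64 floor of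
block 1 was 4.8511e-4).  Under the SHARP column of record (`KBR`): `h ≤ 3.2351e-05`, `2Kη ≤ 5.284e-06`, NK radius `≤ 2.642e-06`, sup `≤ 4.671e-07` (impl-1:
5.943e-6 / 1.0506e-6); under the bracketed C–S column (`KB`): `h ≤ 4.5002e-05`, NK radius `≤ 3.116e-06`, sup `≤ 5.509e-07`.  MODEL bookkeeping; not NS. -/

/-- impl-2, F5(c): `η ≥ ‖G(Ω̄)‖_{X*}` by exact integer arithmetic (UP; value 4.1322e-07). [folklore] -/
def etaB2 : ℚ := (20661 : ℚ) / 50000000000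
/-- impl-2, F5(c), sharp column: `h ≥ KBR²·L_lip·η` (UP; value 3.2351e-05). [folklore] -/
def hBR2 : ℚ := (32351 : ℚ) / 1000000000
/-- impl-2, F5(c), sharp column: crude energy radius `≥ 2·KBR·η` (UP; value 5.284e-06). [folklore] -/
def rEBR2 : ℚ := (1321 : ℚ) / 250000000
/-- impl-2, F5(c), sharp column: crude sup radius `≥ √2·rEBR2/L` (UP; value 9.341e-07). [folklore] -/
def rSupBR2 : ℚ := (9341 : ℚ) / 10000000000
/-- impl-2, F5(c), sharp column: the Newton–Kantorovich LOCATION radius literal `≥ (1 − √(1 − 2h))/(K·L_lip)` (UP; value 2.642e-06). [folklore] -/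
def rEsharpBR2 : ℚ := (1321 : ℚ) / 500000000
/-- impl-2, F5(c), sharp column: sup-norm location radius `≥ √2·rE♯/L ≥ sup|Ω* − Ω̄|` (UP; value 4.671e-07). [folklore] -/
def rSupSharpBR2 : ℚ := (4671 : ℚ) / 10000000000
/-- impl-2, F5(c), bracketed C–S column: `h ≥ KB²·L_lip·η` (UP; value 4.5002e-05). [folklore] -/
def hB2 : ℚ := (22501 : ℚ) / 500000000
/-- impl-2, F5(c), bracketed C–S column: NK location radius literal (UP; value 3.116e-06). [folklore] -/
def rEsharpB2 : ℚ := (779 : ℚ) / 250000000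
/-- impl-2, F5(c), bracketed C–S column: sup-norm location radius (UP; value 5.509e-07). [folklore] -/
def rSupSharpB2 : ℚ := (5509 : ℚ) / 10000000000

/-- F5(c): the upgraded `η` improves block 1's float64 floor. [folklore] -/
theorem etaB2_le_etaB : etaB2 ≤ etaB := by norm_num [etaB2, etaB]
/-- F5(c), sharp column: `hBR2 ≥ KBR²·L_lip·etaB2`. [folklore] -/
theorem hBR2_ge : KBR ^ 2 * Llip * etaB2 ≤ hBR2 := by norm_num [KBR, Llip, etaB2, hBR2]
/-- F5(c), sharp column: discriminant below `1/2`. [folklore] -/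
theorem hBR2_lt_half : hBR2 < 1 / 2 := by norm_num [hBR2]
/-- F5(c), sharp column: `rEBR2 ≥ 2·KBR·etaB2`. [folklore] -/
theorem rEBR2_ge : 2 * KBR * etaB2 ≤ rEBR2 := by norm_num [KBR, etaB2, rEBR2]
/-- F5(c), sharp column: `rSupBR2² ≥ 2·rEBR2²/L²`. [folklore] -/
theorem rSupBR2_sq_ge : 2 * rEBR2 ^ 2 / (L : ℚ) ^ 2 ≤ rSupBR2 ^ 2 := by norm_num [rEBR2, rSupBR2, L]
/-- F5(c), sharp column: the uniqueness window closes, `rEBR2 · KBR · Llip < 1`. [folklore] -/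
theorem rEBR2_mul_KBR_mul_Llip_lt_one : rEBR2 * KBR * Llip < 1 := by norm_num [rEBR2, KBR, Llip]
/-- F5(c), sharp column: `0 ≤ 1 − rE♯·K·L_lip`. [folklore] -/
theorem one_sub_rEsharpBR2_mul_nonneg : 0 ≤ 1 - rEsharpBR2 * KBR * Llip := by norm_num [rEsharpBR2, KBR, Llip]
/-- F5(c), sharp column: `(1 − rE♯·K·L_lip)² ≤ 1 − 2h` (the NK location radius at the literals is at most `rEsharpBR2`). [folklore] -/
theorem rEsharpBR2_sq_le : (1 - rEsharpBR2 * KBR * Llip) ^ 2 ≤ 1 - 2 * hBR2 := by norm_num [rEsharpBR2, KBR, Llip, hBR2]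
/-- F5(c), sharp column: the sharp literal improves the crude one. [folklore] -/
theorem rEsharpBR2_le_rEBR2 : rEsharpBR2 ≤ rEBR2 := by norm_num [rEsharpBR2, rEBR2]
/-- F5(c), sharp column: `rSup♯² ≥ 2·rE♯²/L²`. [folklore] -/
theorem rSupSharpBR2_sq_ge : 2 * rEsharpBR2 ^ 2 / (L : ℚ) ^ 2 ≤ rSupSharpBR2 ^ 2 := by norm_num [rEsharpBR2, rSupSharpBR2, L]
/-- Real form: the Newton–Kantorovich location radius `(1 − √(1 − 2hBR2))/(KBR·L_lip)` is at most `rEsharpBR2`. [folklore] -/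
theorem nk_radius_le_rEsharpBR2 :
    (1 - Real.sqrt (1 - 2 * (hBR2 : ℝ))) / ((KBR : ℝ) * (Llip : ℝ)) ≤ (rEsharpBR2 : ℝ) := by
  have hKL : (0 : ℝ) < (KBR : ℝ) * (Llip : ℝ) := by norm_num [KBR, Llip]
  have h1 : (1 - (rEsharpBR2 : ℝ) * KBR * Llip) ^ 2 ≤ 1 - 2 * (hBR2 : ℝ) := by exact_mod_cast rEsharpBR2_sq_le
  have h2 : 1 - (rEsharpBR2 : ℝ) * KBR * Llip ≤ Real.sqrt (1 - 2 * (hBR2 : ℝ)) := Real.le_sqrt_of_sq_le h1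
  rw [div_le_iff₀ hKL]
  nlinarith [h2]
/-- F5(c), C–S column: `hB2 ≥ KB²·L_lip·etaB2`. [folklore] -/
theorem hB2_ge : KB ^ 2 * Llip * etaB2 ≤ hB2 := by norm_num [KB, Llip, etaB2, hB2]
/-- F5(c), C–S column: discriminant below `1/2`. [folklore] -/
theorem hB2_lt_half : hB2 < 1 / 2 := by norm_num [hB2]
/-- F5(c), C–S column: `0 ≤ 1 − rE♯·KB·L_lip`. [folklore] -/
theorem one_sub_rEsharpB2_mul_nonneg : 0 ≤ 1 - rEsharpB2 * KB * Llip := by norm_num [rEsharpB2, KB, Llip]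
/-- F5(c), C–S column: `(1 − rE♯·KB·L_lip)² ≤ 1 − 2hB2`. [folklore] -/
theorem rEsharpB2_sq_le : (1 - rEsharpB2 * KB * Llip) ^ 2 ≤ 1 - 2 * hB2 := by norm_num [rEsharpB2, KB, Llip, hB2]
/-- F5(c), C–S column: `rSup♯² ≥ 2·rE♯²/L²`. [folklore] -/
theorem rSupSharpB2_sq_ge : 2 * rEsharpB2 ^ 2 / (L : ℚ) ^ 2 ≤ rSupSharpB2 ^ 2 := by norm_num [rEsharpB2, rSupSharpB2, L]
/-- AGREEMENT of the LOCATION radii (F5(c)): implementation 2's Newton–Kantorovich radius literal lies inside implementation 1's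
`rEsharp = 5.943e-6` — same centre ⇒ the two sharp balls are nested ⇒ the same zero, located to the same 1e-6 sup scale by two code-disjoint
arithmetics. [folklore] -/
theorem rEsharpBR2_le_rEsharp : rEsharpBR2 ≤ rEsharp := by norm_num [rEsharp, rEsharpBR2]
/-- implementation 2's sharp location ball is inside implementation 1's crude-literal ball `rE = 1.189e-5`. [folklore] -/
theorem rEsharpBR2_le_rE : rEsharpBR2 ≤ rE := by norm_num [rEsharpBR2, rE]

/-- **The row's sentence at implementation 2's UPGRADED η, fixed-point form, sharp column** (`existsUnique_fixedPoint_quadratic` at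
`(KBR, Llip, etaB2, rEBR2)`): for `‖Sφ‖ ≤ KBR‖φ‖`, `‖Q u v‖ ≤ M‖u‖‖v‖`, `2M ≤ Llip`, `‖g₀‖ ≤ etaB2`, exactly one `δ` with `‖δ‖ ≤ rEBR2` and
`δ = −S(g₀ + Q δ δ)`.  MODEL; interval / integer arithmetic and model assembly are hypotheses. [folklore] -/
theorem existsUnique_fixedPoint_of_rowBR2 (S : Xs →L[ℝ] E) (Q : E →L[ℝ] E →L[ℝ] Xs) (g₀ : Xs) {M : ℝ} (hM : 0 < M)
    (hS : ∀ φ, ‖S φ‖ ≤ (KBR : ℝ) * ‖φ‖) (hQ : ∀ u v, ‖Q u v‖ ≤ M * ‖u‖ * ‖v‖) (hLlip : 2 * M ≤ (Llip : ℝ))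
    (hη : ‖g₀‖ ≤ (etaB2 : ℝ)) :
    ∃ δ ∈ closedBall (0 : E) (rEBR2 : ℝ), δ = -S (g₀ + Q δ δ) ∧
      ∀ δ' ∈ closedBall (0 : E) (rEBR2 : ℝ), δ' = -S (g₀ + Q δ' δ') → δ' = δ := by
  obtain ⟨-, hLlippos, -, -, -⟩ := K_pos_and_Llip_pos
  have hKposR : (0 : ℝ) < (KBR : ℝ) := by exact_mod_cast KBR_pos
  have hetaR : (0 : ℝ) ≤ (etaB2 : ℝ) := by norm_num [etaB2]
  have hhge : (KBR : ℝ) ^ 2 * (Llip : ℝ) * (etaB2 : ℝ) ≤ (hBR2 : ℝ) := by have h' := hBR2_ge; exact_mod_cast h'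
  have hhlt : 2 * ((hBR2 : ℚ) : ℝ) < 1 := by
    have h' : 2 * hBR2 < 1 := by have := hBR2_lt_half; linarith
    exact_mod_cast h'
  have hrEge : 2 * (KBR : ℝ) * (etaB2 : ℝ) ≤ (rEBR2 : ℝ) := by have h' := rEBR2_ge; exact_mod_cast h'
  have hwin : (rEBR2 : ℝ) * (KBR : ℝ) * (Llip : ℝ) < 1 := by have h' := rEBR2_mul_KBR_mul_Llip_lt_one; exact_mod_cast h'
  have hg0 : 0 ≤ ‖g₀‖ := norm_nonneg _
  have hK2 : (0 : ℝ) ≤ (KBR : ℝ) ^ 2 := sq_nonneg _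
  have hle : (KBR : ℝ) ^ 2 * (2 * M) * ‖g₀‖ ≤ (KBR : ℝ) ^ 2 * (Llip : ℝ) * (etaB2 : ℝ) := by
    have h1 : (KBR : ℝ) ^ 2 * (2 * M) ≤ (KBR : ℝ) ^ 2 * (Llip : ℝ) := mul_le_mul_of_nonneg_left hLlip hK2
    exact mul_le_mul h1 hη hg0 (by positivity)
  have hh : 2 * ((KBR : ℝ) ^ 2 * (2 * M) * ‖g₀‖) < 1 := by linarith
  have hr : (1 - Real.sqrt (1 - 2 * ((KBR : ℝ) ^ 2 * (2 * M) * ‖g₀‖))) / ((KBR : ℝ) * (2 * M)) ≤ (rEBR2 : ℝ) := by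
    refine (kantorovich_radius_le hKposR (by positivity) hg0 hh.le).trans ?_
    calc 2 * (KBR : ℝ) * ‖g₀‖ ≤ 2 * (KBR : ℝ) * (etaB2 : ℝ) := by gcongr
      _ ≤ (rEBR2 : ℝ) := hrEge
  have hrE0 : (0 : ℝ) ≤ (rEBR2 : ℝ) := le_trans (by positivity) hrEge
  have hr' : (rEBR2 : ℝ) * (KBR : ℝ) * (2 * M) < 1 := by
    calc (rEBR2 : ℝ) * (KBR : ℝ) * (2 * M) ≤ (rEBR2 : ℝ) * (KBR : ℝ) * (Llip : ℝ) :=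
          mul_le_mul_of_nonneg_left hLlip (mul_nonneg hrE0 hKposR.le)
      _ < 1 := hwin
  exact existsUnique_fixedPoint_quadratic S Q g₀ hKposR hM hS hQ le_rfl hh hr hr'

end CertificateViscousSheetR
end Summit.NavierStokesRegularity.OSWSelfSimilar

end
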